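import Literature.NumberTheory.DiophantineGeometry.FaltingsHeightJInvariantExplicit
import Mathlib.NumberTheory.Modular
import HarnessLib

/-!
# Every complex elliptic curve in the fundamental domain: `τ ∈ 𝒟` with `j = E₄(τ)³/Δ(τ)`

Topic `NumberTheory/DiophantineGeometry`. For an elliptic curve `V/ℂ` with period lattice `Λ`,
Silverman (*Heights and elliptic curves*, 1986, §2) and Löbrich (*A gap in the spectrum of the
Faltings height*, JTNB 29 (2017), §2: "we choose `τ_σ ∈ F̄`") normalise `Λ = ω(ℤτ + ℤ)` with `τ` in
the closed fundamental domain `F̄ = 𝒟 = {|τ| ≥ 1, |Re τ| ≤ 1/2}` of `SL₂(ℤ)`; then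
`c₄ = 16π⁴ω⁻⁴E₄(τ)`, `Δ_V = 2¹²π¹²ω⁻¹²Δ(τ)`, `|j_V| = |E₄(τ)|³/|Δ(τ)|`, `covol(Λ) = |ω|² Im τ`, and the
archimedean term of the Faltings height satisfies
`log max(|j_V|,1) + archTerm_V = log(4096π¹²) + log(max(|j_V|,1)·|Δ(τ)|) + 6 log Im τ`.

The tree's `FaltingsHeightJInvariantProofs` / `FaltingsHeightJInvariantExplicit` prove exactly this
with the WEAKER normalisation `Im τ ≥ 1/2` (Mathlib `ModularGroup.exists_one_half_le_im_smul`) and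
keep the lemmas private. This file repeats them (private) with the single change
`exists_one_half_le_im_smul ↦ ModularGroup.exists_smul_mem_fd` (Mathlib's first fundamental-domain
lemma) and EXPORTS the normal form (`exists_fd_normalForm`, `exists_fd_tau`), which the Löbrich-type
estimate `FaltingsHeightJInvariantLobrich` (where `|E₄| ≤ 5/2` on `𝒟` is what sharpens Silverman's
constant) consumes. Classical; everything proved; no definitions.

## References

* J. H. Silverman, *Heights and elliptic curves*, in Arithmetic Geometry (1986), §2. [Silverman1986]
* J. H. Silverman, *The Arithmetic of Elliptic Curves*, 2nd ed. (2009), VI.3.6, C.12. [SilvermanAEC2009]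
* S. Löbrich, *A gap in the spectrum of the Faltings height*, JTNB 29 (2017), §2–3. [Lobrich2017]
-/

noncomputable section

namespace Literature.NumberTheory.DiophantineGeometry

namespace FaltingsHeightFd

open _root_.NumberField _root_.WeierstrassCurve
open _root_.Complex _root_.UpperHalfPlane _root_.EisensteinSeries _root_.ModularForm
open scoped MatrixGroups Real Modular
open Literature.NumberTheory.EllipticCurves

/-! ### Reduction of a period lattice to `ω(ℤτ + ℤ)` with `τ` in the fundamental domain `𝒟`
(the lemmas of `FaltingsHeightJInvariantProofs` / `FaltingsHeightJInvariantExplicit`, private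
there, with `ModularGroup.exists_one_half_le_im_smul` replaced by `ModularGroup.exists_smul_mem_fd`) -/

/-- `covol(ℤω₁ + ℤω₂) = |Re ω₁ Im ω₂ − Im ω₁ Re ω₂|` for Lebesgue measure on `ℂ`. [folklore] -/
private theorem covolume_lattice_eq (L : PeriodPair) :
    ZLattice.covolume L.lattice = |L.ω₁.re * L.ω₂.im - L.ω₁.im * L.ω₂.re| := by
  classical
  rw [ZLattice.covolume_eq_det_mul_measureReal L.lattice MeasureTheory.volume L.latticeBasis
    Complex.basisOneI]
  have h1 : MeasureTheory.volume.real (ZSpan.fundamentalDomain Complex.basisOneI) = 1 := by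
    rw [MeasureTheory.measureReal_congr
      (ZSpan.fundamentalDomain_ae_parallelepiped Complex.basisOneI MeasureTheory.volume),
      MeasureTheory.measureReal_def, ← Complex.toBasis_orthonormalBasisOneI,
      OrthonormalBasis.coe_toBasis, Complex.orthonormalBasisOneI.volume_parallelepiped]
    simp
  rw [h1, mul_one, Module.Basis.det_apply, Matrix.det_fin_two]
  simp only [Module.Basis.toMatrix_apply, Complex.coe_basisOneI_repr, Function.comp_apply,
    PeriodPair.latticeBasis_zero, PeriodPair.latticeBasis_one, Matrix.cons_val_zero,
    Matrix.cons_val_one]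
  congr 1; ring

/-- The lattice sums `G_k(Λ) = ∑_{λ ∈ Λ} λ^{-k}` written over `ℤ²`. [folklore] -/
private theorem G_eq_tsum_prod (L : PeriodPair) (k : ℕ) :
    L.G k = ∑' x : ℤ × ℤ, ((x.1 * L.ω₁ + x.2 * L.ω₂) ^ k)⁻¹ := by
  rw [PeriodPair.G, ← (Equiv.tsum_eq L.latticeEquivProd.symm.toEquiv
    (fun l : L.lattice => ((l : ℂ) ^ k)⁻¹))]
  congr with x
  simp [L.latticeEquiv_symm_apply]

/-- Reindexing `ℤ × ℤ ≃ (Fin 2 → ℤ)` in the Eisenstein summands. [folklore] -/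
private theorem tsum_prod_eisSummand (k : ℤ) (τ : ℍ) :
    ∑' x : ℤ × ℤ, eisSummand k ![x.2, x.1] τ = ∑' v : Fin 2 → ℤ, eisSummand k v τ := by
  rw [← Equiv.tsum_eq ((Equiv.prodComm ℤ ℤ).trans (finTwoArrowEquiv ℤ).symm)]
  rfl

/-- `∑_{(m,n) ∈ ℤ²} (mτ + n)^{-k} = 2ζ(k) E_k(τ)`. [folklore] -/
private theorem two_mul_zeta_mul_E_apply {k : ℕ} (hk : 3 ≤ k) (τ : ℍ) :
    2 * riemannZeta k * E hk τ = ∑' v : Fin 2 → ℤ, eisSummand k v τ := by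
  rw [tsum_eisSummand_eq_riemannZeta_mul_eisensteinSeries hk,
    show E hk τ = (1 / 2 : ℂ) • eisensteinSeriesSIF (N := 1) 0 k τ from rfl,
    eisensteinSeriesSIF_apply, smul_eq_mul]
  ring

/-- `G_k(ℤω₁ + ℤω₂) = ω₁^{-k} · 2ζ(k) E_k(ω₂/ω₁)` when `Im(ω₂/ω₁) > 0`. [folklore] -/
private theorem G_eq_of_im_pos (L : PeriodPair) (h : 0 < (L.ω₂ / L.ω₁).im) {k : ℕ}
    (hk : 3 ≤ k) :
    L.G k = (L.ω₁ ^ k)⁻¹ * (2 * riemannZeta k * E hk (UpperHalfPlane.mk _ h)) := by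
  have hω₁ : L.ω₁ ≠ 0 := by
    rintro h0
    simp [h0] at h
  rw [two_mul_zeta_mul_E_apply, ← tsum_prod_eisSummand, G_eq_tsum_prod, ← tsum_mul_left]
  congr with x
  rw [eisSummand, zpow_neg, zpow_natCast, ← mul_inv, ← mul_pow]
  congr 2
  simp only [Matrix.cons_val_zero, Matrix.cons_val_one]
  field_simp
  ring

/-- `Im(b/a) · |a|² = Re a Im b − Im a Re b`. [folklore] -/
private theorem im_div_mul_normSq (a b : ℂ) (ha : a ≠ 0) :
    (b / a).im * Complex.normSq a = a.re * b.im - a.im * b.re := by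
  rw [Complex.div_im]
  field_simp [(Complex.normSq_pos.mpr ha).ne']

/-- Reduction when `Im(ω₂/ω₁) > 0`: with `τ₀ = ω₂/ω₁` and `γ ∈ SL₂(ℤ)` such that `γτ₀ ∈ 𝒟`
(Mathlib's first fundamental-domain lemma `ModularGroup.exists_smul_mem_fd`), put `τ = γτ₀`,
`ω = ω₁ · (cτ₀ + d)`; then `G_k(Λ) = ω^{-k} 2ζ(k)E_k(τ)` and `covol(Λ) = |ω|² Im τ`. [folklore] -/
private theorem exists_fd_normalForm_of_im_pos (L : PeriodPair) (h : 0 < (L.ω₂ / L.ω₁).im) :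
    ∃ (ω : ℂ) (τ : ℍ), ω ≠ 0 ∧ τ ∈ 𝒟 ∧
      L.G 4 = (ω ^ 4)⁻¹ * (2 * riemannZeta (4 : ℕ) * E₄ τ) ∧
      L.G 6 = (ω ^ 6)⁻¹ * (2 * riemannZeta (6 : ℕ) * E₆ τ) ∧
      ZLattice.covolume L.lattice = ‖ω‖ ^ 2 * τ.im := by
  have hω₁ : L.ω₁ ≠ 0 := by
    rintro h0
    simp [h0] at h
  set τ₀ : ℍ := UpperHalfPlane.mk _ h with hτ₀
  obtain ⟨γ, hγ⟩ := ModularGroup.exists_smul_mem_fd τ₀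
  have hmem : (γ : GL (Fin 2) ℝ) ∈ 𝒮ℒ := ⟨γ, rfl⟩
  have hd : denom γ τ₀ ≠ 0 := denom_ne_zero γ τ₀
  refine ⟨L.ω₁ * denom γ τ₀, γ • τ₀, mul_ne_zero hω₁ hd, hγ, ?_, ?_, ?_⟩
  · have h4 := SlashInvariantForm.slash_action_eqn'' E₄ hmem τ₀
    rw [ModularGroup.sl_moeb, h4, G_eq_of_im_pos L h (k := 4) (by norm_num)]
    rw [mul_pow, mul_inv, zpow_ofNat]
    field_simp
    rfl
  · have h6 := SlashInvariantForm.slash_action_eqn'' E₆ hmem τ₀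
    rw [ModularGroup.sl_moeb, h6, G_eq_of_im_pos L h (k := 6) (by norm_num)]
    rw [mul_pow, mul_inv, zpow_ofNat]
    field_simp
    rfl
  · rw [ModularGroup.im_smul_eq_div_normSq, covolume_lattice_eq, norm_mul, mul_pow,
      Complex.sq_norm, Complex.sq_norm]
    field_simp
    rw [show τ₀.im = (L.ω₂ / L.ω₁).im from rfl]
    rw [abs_of_pos]
    · have := im_div_mul_normSq L.ω₁ L.ω₂ hω₁
      linarith
    · have := im_div_mul_normSq L.ω₁ L.ω₂ hω₁
      have hn : 0 < Complex.normSq L.ω₁ := Complex.normSq_pos.mpr hω₁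
      nlinarith

/-- **Reduction of an arbitrary period lattice into the fundamental domain**:
`G₄(Λ) = ω⁻⁴ · 2ζ(4) E₄(τ)`, `G₆(Λ) = ω⁻⁶ · 2ζ(6) E₆(τ)` and `covol(Λ) = |ω|² Im τ` for some
`ω ≠ 0` and `τ ∈ 𝒟 = {|τ| ≥ 1, |Re τ| ≤ 1/2}` (interchange the periods if `Im(ω₂/ω₁) < 0`) —
Silverman 1986, §2: "we choose our `τ_v`'s in the usual fundamental domain"; Löbrich 2017, §2 (before
Def. 2.3): "choose a `τ_σ ∈ ℍ` such that `j(τ_σ) = j_σ`" and §4: "the function `V` is invariant under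
the action of `SL₂(ℤ)` on `ℍ` … Therefore we may assume that all the `{τ_σ}` lie in `F̄`"
(`F̄ = {τ ∈ ℍ : −½ ≤ Re τ ≤ ½ and |τ| ≥ 1}`, loc. cit. §2), via Mathlib's first fundamental-domain
lemma `ModularGroup.exists_smul_mem_fd`.
[cite: Silverman1986, §2 (p. 256, choice of τ_v in the fundamental domain)]
[cite: Lobrich2017, §2 (choice of τ_σ, definition of F̄) and §4 (proof of Thm. 4.1, "all the τ_σ lie in F̄")] -/
theorem exists_fd_normalForm (L : PeriodPair) :
    ∃ (ω : ℂ) (τ : ℍ), ω ≠ 0 ∧ τ ∈ 𝒟 ∧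
      L.G 4 = (ω ^ 4)⁻¹ * (2 * riemannZeta (4 : ℕ) * E₄ τ) ∧
      L.G 6 = (ω ^ 6)⁻¹ * (2 * riemannZeta (6 : ℕ) * E₆ τ) ∧
      ZLattice.covolume L.lattice = ‖ω‖ ^ 2 * τ.im := by
  have hpos := ZLattice.covolume_pos L.lattice MeasureTheory.volume
  rw [covolume_lattice_eq] at hpos
  have hD : L.ω₁.re * L.ω₂.im - L.ω₁.im * L.ω₂.re ≠ 0 := abs_pos.mp hpos
  rcases lt_or_gt_of_ne hD with hneg | hpos'
  · -- interchange the periods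
    have hω₂ : L.ω₂ ≠ 0 := by
      rintro h0
      simp [h0] at hneg
    let L' : PeriodPair :=
      { ω₁ := L.ω₂
        ω₂ := L.ω₁
        indep := by
          rw [LinearIndependent.pair_iff]
          intro s t hst
          have := (LinearIndependent.pair_iff.mp L.indep) t s (by rw [add_comm]; exact hst)
          exact ⟨this.2, this.1⟩ }
    have hlat : L'.lattice = L.lattice := by
      rw [PeriodPair.lattice, PeriodPair.lattice, Set.pair_comm]
    have hG : ∀ n, L'.G n = L.G n := fun n => by rw [PeriodPair.G, PeriodPair.G, hlat]
    have hc : ZLattice.covolume L'.lattice = ZLattice.covolume L.lattice := by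
      rw [covolume_lattice_eq, covolume_lattice_eq, abs_sub_comm]
      congr 1; ring
    have h : 0 < (L'.ω₂ / L'.ω₁).im := by
      have := im_div_mul_normSq L.ω₂ L.ω₁ hω₂
      have hn : 0 < Complex.normSq L.ω₂ := Complex.normSq_pos.mpr hω₂
      have h' : L.ω₂.re * L.ω₁.im - L.ω₂.im * L.ω₁.re =
          -(L.ω₁.re * L.ω₂.im - L.ω₁.im * L.ω₂.re) := by ring
      exact (mul_pos_iff_of_pos_right hn).mp (by rw [this, h']; linarith)
    obtain ⟨ω, τ, h1, h2, h3, h4, h5⟩ := exists_fd_normalForm_of_im_pos L' h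
    exact ⟨ω, τ, h1, h2, (hG 4) ▸ h3, (hG 6) ▸ h4, hc ▸ h5⟩
  · have hω₁ : L.ω₁ ≠ 0 := by
      rintro h0
      simp [h0] at hpos'
    have h : 0 < (L.ω₂ / L.ω₁).im := by
      have := im_div_mul_normSq L.ω₁ L.ω₂ hω₁
      have hn : 0 < Complex.normSq L.ω₁ := Complex.normSq_pos.mpr hω₁
      exact (mul_pos_iff_of_pos_right hn).mp (by rw [this]; exact hpos')
    exact exists_fd_normalForm_of_im_pos L h

/-! ### The dictionary `c₄ = 16π⁴ω⁻⁴E₄(τ)`, `Δ_V = 2¹²π¹²ω⁻¹²Δ(τ)`, `j_V = E₄³/Δ(τ)` (repeated) -/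

/-- `c₄ = 12 g₂ = 16π⁴ ω⁻⁴ E₄(τ)` for a period lattice in normal form. [folklore] -/
private theorem c₄_eq_of_normalForm (V : WeierstrassCurve ℂ) {L : PeriodPair}
    (h₂ : L.g₂ = V.c₄ / 12) {ω : ℂ} {τ : ℍ}
    (hG4 : L.G 4 = (ω ^ 4)⁻¹ * (2 * riemannZeta (4 : ℕ) * E₄ τ)) :
    V.c₄ = 16 * π ^ 4 * (ω ^ 4)⁻¹ * E₄ τ := by
  have h1 := h₂
  rw [PeriodPair.g₂, hG4, Nat.cast_ofNat, riemannZeta_four] at h1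
  have : V.c₄ = 12 * (60 * ((ω ^ 4)⁻¹ * (2 * (π ^ 4 / 90) * E₄ τ))) := by
    rw [h1]; ring
  rw [this]; ring

/-- `c₆ = 216 g₃ = 64π⁶ ω⁻⁶ E₆(τ)` for a period lattice in normal form. [folklore] -/
private theorem c₆_eq_of_normalForm (V : WeierstrassCurve ℂ) {L : PeriodPair}
    (h₃ : L.g₃ = V.c₆ / 216) {ω : ℂ} {τ : ℍ}
    (hG6 : L.G 6 = (ω ^ 6)⁻¹ * (2 * riemannZeta (6 : ℕ) * E₆ τ)) :
    V.c₆ = 64 * π ^ 6 * (ω ^ 6)⁻¹ * E₆ τ := by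
  have h1 := h₃
  rw [PeriodPair.g₃, hG6, Nat.cast_ofNat, PeriodPair.riemannZeta_six] at h1
  have : V.c₆ = 216 * (140 * ((ω ^ 6)⁻¹ * (2 * (π ^ 6 / 945) * E₆ τ))) := by
    rw [h1]; ring
  rw [this]; ring

/-- `Δ_V = (c₄³ − c₆²)/1728 = 2¹²π¹² ω⁻¹² Δ(τ)`. [folklore] -/
private theorem Δ_eq_of_normalForm (V : WeierstrassCurve ℂ) {L : PeriodPair}
    (h₂ : L.g₂ = V.c₄ / 12) (h₃ : L.g₃ = V.c₆ / 216) {ω : ℂ} {τ : ℍ}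
    (hG4 : L.G 4 = (ω ^ 4)⁻¹ * (2 * riemannZeta (4 : ℕ) * E₄ τ))
    (hG6 : L.G 6 = (ω ^ 6)⁻¹ * (2 * riemannZeta (6 : ℕ) * E₆ τ)) :
    V.Δ = 4096 * π ^ 12 * (ω ^ 12)⁻¹ * ModularForm.discriminant τ := by
  have h := V.c_relation
  rw [c₄_eq_of_normalForm V h₂ hG4, c₆_eq_of_normalForm V h₃ hG6] at h
  rw [ModularForm.discriminant_eq_E₄_cube_sub_E₆_sq]
  have : V.Δ = ((16 * π ^ 4 * (ω ^ 4)⁻¹ * E₄ τ) ^ 3 -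
      (64 * π ^ 6 * (ω ^ 6)⁻¹ * E₆ τ) ^ 2) / 1728 := by
    rw [← h]; ring
  rw [this]
  ring

/-- `|j_V| = |E₄(τ)|³/|Δ(τ)|` in normal form (`j = c₄³/Δ`, `(16π⁴)³ = 2¹²π¹²`). [folklore] -/
private theorem norm_j_eq_of_normalForm (V : WeierstrassCurve ℂ) [V.IsElliptic] {L : PeriodPair}
    (h₂ : L.g₂ = V.c₄ / 12) (h₃ : L.g₃ = V.c₆ / 216) {ω : ℂ} {τ : ℍ} (hω : ω ≠ 0)
    (hG4 : L.G 4 = (ω ^ 4)⁻¹ * (2 * riemannZeta (4 : ℕ) * E₄ τ))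
    (hG6 : L.G 6 = (ω ^ 6)⁻¹ * (2 * riemannZeta (6 : ℕ) * E₆ τ)) :
    ‖V.j‖ = ‖E₄ τ‖ ^ 3 / ‖ModularForm.discriminant τ‖ := by
  have hΔ : V.Δ ≠ 0 := V.isUnit_Δ.ne_zero
  have hd : ModularForm.discriminant τ ≠ 0 := ModularForm.discriminant_ne_zero τ
  have hπ : (π : ℂ) ≠ 0 := Complex.ofReal_ne_zero.mpr Real.pi_ne_zero
  have hj : V.j = V.c₄ ^ 3 / V.Δ := by
    rw [WeierstrassCurve.j, Units.val_inv_eq_inv_val, WeierstrassCurve.coe_Δ', div_eq_inv_mul]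
  rw [hj, c₄_eq_of_normalForm V h₂ hG4, Δ_eq_of_normalForm V h₂ h₃ hG4 hG6]
  rw [norm_div, norm_pow]
  have key : (16 * (π : ℂ) ^ 4 * (ω ^ 4)⁻¹ * E₄ τ) ^ 3 /
      (4096 * π ^ 12 * (ω ^ 12)⁻¹ * ModularForm.discriminant τ) =
      E₄ τ ^ 3 / ModularForm.discriminant τ := by
    field_simp
    ring
  rw [← norm_pow, ← norm_div, key, norm_div, norm_pow]

/-- **Every elliptic curve over `ℂ` in the fundamental domain**: there is `τ ∈ 𝒟` with
`|j_V| = |E₄(τ)|³/|Δ(τ)|` and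
`log max(|j_V|, 1) + archTerm_V = log(4096 π¹²) + log(max(|j_V|, 1)·|Δ(τ)|) + 6 log Im τ`
(`archTerm_V = log|Δ_V| + 6 log((i/2)∫ω∧ω̄)`; the identity of the proofs of
`FaltingsHeightExplicit.nine_le_log_max_j_add_faltingsArchTerm` / `log_max_j_add_faltingsArchTerm_le`,
exported): Löbrich's Def. 2.3 writes the archimedean part of the Faltings height as
`−(1/(12[K:ℚ])) Σ_σ log(|Δ̃(τ_σ)| Im(τ_σ)⁶)` with `Δ̃ = (2π)¹² Δ` and `τ_σ ∈ F̄`, `j(τ_σ) = σ(j_E)`; in the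
tree's normalisation (`archTerm = log|Δ_V| + 6 log((i/2)∫ω∧ω̄)`, Silverman 1986 Prop. 1.1) this is the
displayed identity. [cite: Lobrich2017, §2 Def. 2.3 (with τ_σ ∈ F̄, §4)]
[cite: Silverman1986, Prop. 1.1 and §2 (p. 256)] -/
theorem exists_fd_tau (V : WeierstrassCurve ℂ) [V.IsElliptic] :
    ∃ τ : ℍ, τ ∈ 𝒟 ∧ ‖V.j‖ = ‖E₄ τ‖ ^ 3 / ‖ModularForm.discriminant τ‖ ∧
      Real.log (max ‖V.j‖ 1) + V.faltingsArchTerm =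
        Real.log (4096 * π ^ 12) + Real.log (max ‖V.j‖ 1 * ‖ModularForm.discriminant τ‖) +
          6 * Real.log τ.im := by
  obtain ⟨L, h₂, h₃⟩ := V.exists_periodPair_of_isElliptic'
  obtain ⟨ω, τ, hω, hτ, hG4, hG6, hcov⟩ := exists_fd_normalForm L
  refine ⟨τ, hτ, norm_j_eq_of_normalForm V h₂ h₃ hω hG4 hG6, ?_⟩
  set y : ℝ := τ.im with hy_def
  set d : ℝ := ‖ModularForm.discriminant τ‖ with hd_def
  have hypos : 0 < y := τ.im_pos
  have hd : 0 < d := norm_pos_iff.mpr (ModularForm.discriminant_ne_zero τ)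
  have hωpos : 0 < ‖ω‖ := norm_pos_iff.mpr hω
  have hmaxpos : 0 < max ‖V.j‖ 1 := lt_max_of_lt_right one_pos
  set P₃ : ℝ := 4096 * π ^ 12 / ‖ω‖ ^ 12 with hP₃
  have hP₃pos : 0 < P₃ := by positivity
  have hΔn : ‖V.Δ‖ = P₃ * d := by
    rw [Δ_eq_of_normalForm V h₂ h₃ hG4 hG6, hP₃]
    simp [norm_inv, norm_pow, hd_def, div_eq_mul_inv, abs_of_pos Real.pi_pos]
  have hcp : V.complexPeriod / 2 = ‖ω‖ ^ 2 * y := by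
    rw [V.complexPeriod_eq_two_mul_covolume' h₂ h₃, hcov]
    ring
  have key : P₃ * (‖ω‖ ^ 2 * y) ^ 6 = 4096 * π ^ 12 * y ^ 6 := by
    rw [hP₃]
    field_simp
  calc Real.log (max ‖V.j‖ 1) + V.faltingsArchTerm
      = Real.log (max ‖V.j‖ 1) + (Real.log (P₃ * d) + 6 * Real.log (‖ω‖ ^ 2 * y)) := by
        rw [WeierstrassCurve.faltingsArchTerm, hΔn, hcp]
    _ = (Real.log (max ‖V.j‖ 1) + Real.log d) +
          (Real.log P₃ + 6 * Real.log (‖ω‖ ^ 2 * y)) := by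
        rw [Real.log_mul hP₃pos.ne' hd.ne']; ring
    _ = Real.log (max ‖V.j‖ 1 * d) + Real.log (4096 * π ^ 12 * y ^ 6) := by
        rw [← Real.log_mul hmaxpos.ne' hd.ne', ← key,
          Real.log_mul hP₃pos.ne' (by positivity), Real.log_pow]
        push_cast
        ring
    _ = Real.log (4096 * π ^ 12) + Real.log (max ‖V.j‖ 1 * d) + 6 * Real.log y := by
        rw [Real.log_mul (show (4096 * π ^ 12 : ℝ) ≠ 0 by positivity)
          (show (y ^ 6 : ℝ) ≠ 0 by positivity), Real.log_pow]
        push_cast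
        ring


end FaltingsHeightFd

end Literature.NumberTheory.DiophantineGeometry

end
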